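import Summits.HodgeConjecture.HodgeConjecture.Theorems.F0P6aPELWitnessEDefs        -- (D) ED. 5 (tree 474c236c): `AuxChartGS`, `IsCMTypeThrough`, `GSAdele`
import Literature.AlgebraicGeometry.ShimuraVarieties.UnitaryCurveAuxiliaryIntegralActionV             -- ★ E1 7b: `SymplecticFrameV`, `auxToGspFinV`, `auxToGspRatV`, `framePV`, `frameQV`, `auxLevelV`
import Literature.AlgebraicGeometry.ShimuraVarieties.UnitaryCurveAuxiliaryComplexStructureInjective   -- ★ E2: `auxComplexStructureV` (Deligne՚s `J_{Φ′}` of a frame)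
import HarnessLib

/-!
# `F0P6aChartFramePin` — ★ RE-HOME (rung-0 re-homing task, books INVENTORY §8.4 M-3; LEAD F0P6-plan (g4) «M-72») of the crux workfile `Lines/F0_P6a_ChartFramePin.lean`

This `Theorems/` module is the TREE BYTES of `Summits/HodgeConjecture/HodgeConjecture/Cruxes/HLiu418/Lines/F0_P6a_ChartFramePin.lean` (edition of record,
tree sha16 9cb8837e236e6097, 58 l., code-`sorry`-free) with the NAMESPACE KEPT — `Summit.HodgeConjecture.HodgeConjecture.Cruxes.HLiu418.F0P6aChartFramePin` — so that every
fully-qualified name (`IsChartOfFrame`; 1 declarations) is UNCHANGED; only this module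
docstring is re-headed and the `Lines` imports are switched to their ★ re-homed twins (`F0_P6a_PELWitnessEDefs` → `Theorems.F0P6aPELWitnessEDefs`).  Why a re-home: a `Theorems/` file cannot import a `Lines/` workfile (F0P6-ref1 o-6), and closing
stmt-HodgeConjecture-24832 `--as proved --by <Theorems decl>` at rung 0 needs the sorry-free Lines chain behind the gate (RE-HOME MAP v1.1, LA7-plan (g4),
2026-09-02; director g27 s1336 (R1)–(R3)).    Lines importers of the original: `F0_P6a_EExports`.
After this file is ★ the Lines workfile is meant to become a one-import SHIM of it (a `Lines/` write, batched per cone on the LEAD's word), so no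
environment ever holds two copies (NO-CROSS-IMPORT rule, «M-72» (3)).  It asserts nothing beyond what the workfile already proves.

## Original module docstring (verbatim)
# `F0_P6a_ChartFramePin` — THE FRAME PIN «`C` is the E3 chart of the E1 frame `Fr`» (shared 1-definition module; E-pen A-p01 (g28), LA5-plan (g3) 06:15:44Z (5) ask)

CRUX `stmt-HodgeConjecture-24832` (HLiu418), sub-line P6a.  ONE `def … : Prop`, no theorem, no `sorry`, no instance, no notation.  Imported by the X-LEAF
`Lines/F0_P6a_EExports.lean` (its two socket letters `RecordEHeckeReading` ∕ `RecordESheetReading` bind `(ξ k Fr) (hpin : IsChartOfFrame hΦ C ξ k Fr)`) AND by the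
closer leaves that pay those sockets (`Lines/F0_P6a_StubEHECKE.lean`, LA5-plan (g3); `Lines/F0_P6a_StubESHEET.lean`, (S8)) — which cannot import the X-leaf (it
imports them) — so that socket and closer state the pin with THE SAME constant and the X-leaf closes `stub_EHECKE := …stub_EHECKE_of_line` with no bridging.
WHY A PIN (LAref-E X-LEAF #1 (n2); LA5-plan∕LA6-p02∕LA4-p05 organ currency): the organ hands prove (H-E)∕(T-E) in FRAME currency — the torus leg `ũ_V(1, t)` of ★ 7a∕7b
carries the central twist of the sheet law (★ `exists_siegelRecipDatum_centralTwist`), the `w`-adic lattices `latticeOfGL (C.b a)` are `𝒪_F`-lattices of `F²` only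
THROUGH `b = ũ_V(·,1)` — none of which an abstract inhabitant of the 60-field interface `AuxChartGS` exposes.  The pin is typed at the chart՚s own `C.g`, `C.δ`
(no `HEq`); the E3 chart that the X-leaf՚s `chart_of_frame` builds satisfies it by `rfl` ×3 + the ★ 7b reading conjunct.
HONEST LABEL: HC_CM is proved only modulo the 7 printed citations (2 remaining named inputs hLiu418 24832, h413 24833) until rung 0 closes; this workfile asserts nothing.
[cite: Deligne1979ShimuraVarieties, 2.3.10] [cite: RapoportSmithlingZhang2020Diagonal, §3.2 pp. 11–14] [cite: Kottwitz1992, §5 p. 390]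
-/

set_option autoImplicit false

noncomputable section

namespace Summit.HodgeConjecture.HodgeConjecture.Cruxes.HLiu418.F0P6aChartFramePin

set_option linter.dupNamespace false  -- `Summit.HodgeConjecture.HodgeConjecture.…` BY DESIGN (D-0017)

open NumberField
open Literature.AlgebraicGeometry.Motives (CMType)
open Literature.AlgebraicGeometry.ShimuraVarieties Literature.AlgebraicGeometry.ShimuraVarieties.UnitaryCanonicalModel
open Literature.AlgebraicGeometry.ModuliOfAbelianVarieties
open Literature.AlgebraicGeometry.ShimuraVarieties.UnitaryCanonicalModel.Aux (ratBasis torusFinAdelic)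
open Literature.AlgebraicGeometry.ShimuraVarieties.UnitaryCurve Literature.AlgebraicGeometry.ShimuraVarieties.UnitaryCurve.AuxV
open Literature.NumberTheory.Automorphic Literature.NumberTheory.Automorphic.UnitaryGroup
open Literature.NumberTheory.Automorphic.Liu2021.AppendixC (C5.OpenCompactSubgroup C5.SmallLevel)
open Literature.NumberTheory.ComplexMultiplication.CMTypeOps (flip bar)
open Summit.HodgeConjecture.HodgeConjecture.Cruxes.HLiu418.F0P6aPELWitnessE (AuxChartGS IsCMTypeThrough GSAdele)

/-- **`IsChartOfFrame hΦ C ξ k Fr`** — the chart `C : AuxChartGS …` IS the E3 chart of the E1 integral symplectic frame `Fr` of `k•ψ_ξ` (typed at the chart՚s own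
`C.g`, `C.δ`): its complex structure is Deligne՚s `J_{Φ′}` of the frame at `Φ′ = flip ι₁ (bar Φ)` (★ `auxComplexStructureV`), its Hodge embeddings are the frame՚s
carrier on the unitary factor (`C.b = ũ_V ∘ inl`, `C.bq = ũ_ℚ ∘ inl` — so the TORUS leg `ũ_V(1, t)` of ★ 7a∕7b is available to the organs), and its frame reading
`C.ρ₀` is the frame՚s integral `𝓞_F`-reading (★ 7b conjunct VERBATIM).  A `Prop`; nothing is asserted by declaring it.
[cite: Deligne1979ShimuraVarieties, 2.3.10] [cite: RapoportSmithlingZhang2020Diagonal, §3.2 pp. 11–14] [cite: Kottwitz1992, §5 p. 390] -/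
def IsChartOfFrame {F : Type} [Field F] [NumberField F] [IsCMField F] {ι₁ : F →+* ℂ}
    {Jstar : Matrix (Fin 2) (Fin 2) F} {K₀ : C5.OpenCompactSubgroup (GSAdele F Jstar)} {S : RecordSystemGS F Jstar ι₁ K₀} {Kc : C5.SmallLevel K₀}
    {Fi : Type} [Field Fi] [NumberField Fi] [Algebra F Fi] {τE : Fi →+* ℂ} {Φ : Set (F →+* ℂ)} (hΦ : IsCMTypeThrough ι₁ Φ)
    (C : AuxChartGS F ι₁ Jstar K₀ S Kc Fi τE Φ) (ξ : F) (k : ℕ)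
    (Fr : SymplecticFrameV F (RingHom.id F) Jstar ((k : ℚ) • ξ) C.g C.δ) : Prop :=
  C.J = auxComplexStructureV Fr ι₁ (flip ι₁ (bar (⟨Φ, hΦ.2⟩ : CMType F))) ∧
  C.b = (auxToGspFinV Fr).comp (MonoidHom.inl _ ↥(torusFinAdelic F)) ∧
  C.bq = (auxToGspRatV Fr).comp (MonoidHom.inl _ _) ∧
  ∀ b : 𝓞 F, (C.ρ₀ b).map (Int.cast : ℤ → ℚ) =
    framePV Fr * resMatrix (m := Fin 2) (ratBasis F) (((b : 𝓞 F) : F) • (1 : Matrix (Fin 2) (Fin 2) F)) * frameQV Fr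

end Summit.HodgeConjecture.HodgeConjecture.Cruxes.HLiu418.F0P6aChartFramePin

end
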